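import Mathlib
import Literature.NumberTheory.LFunctions.SemimultiplicativeMoebiusCircle
import Literature.NumberTheory.Sieve.MatomakiRadziwillLemma14SmoothRefutation
import HarnessLib

/-!
# Venture YMGap, track ROBUST-BALL — A BERNSTEIN-BLOCK CENTRAL LIMIT CRITERION (characteristic functions, then
# convergence in distribution by Lévy's continuity theorem)

HONEST FRAMING. WHAT THIS IS: a venture file (cell `pub-ymgap`, track Y2 ROBUST-BALL, seat ds-3, theorems only): the probabilistic
core of the object «C-CLT» (Gaussian fluctuations of block observables at strong coupling). Pure probability — no lattice, no gauge
field. A sequence of real random variables `T n = Σ_{j < k n} Y n j + R n` on ONE probability space with: `∫|R n| → 0`; blocks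
`Y n j` (`j < k n`) measurable, distributed as `Y n 0`, centred, `|Y n j| ≤ b n`, `b n → 0`; `k n · E[(Y n 0)²] → σ²`; and, for every
`t`, the DEPENDENCE DEFECT `Σ_{j<k n} ‖E[e^{it Σ_{i∈[j,k n)} Y n i}] − E[e^{it Y n j}]·E[e^{it Σ_{i∈[j+1,k n)} Y n i}]‖ → 0` — satisfies
`E[e^{it T n}] → e^{−σ²t²/2}` (★ `tendsto_integral_cexp_of_blocks`), hence converges in distribution to `N(0, σ²)` = Mathlib's
`gaussianReal 0 σ²`, `σ² = 0` allowed (★★ `tendstoInDistribution_of_tendsto_integral_cexp`, Lévy: Mathlib's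
`ProbabilityMeasure.tendsto_iff_tendsto_charFun` + `charFun_gaussianReal`). Tools: `norm_cexp_sub_taylor_le`
(`‖e^{ix} − (1 + ix − x²/2)‖ ≤ |x|³/6 + x⁴/24`), the tree's `Konieczny.norm_pow_sub_pow_le` (`‖aᵏ − bᵏ‖ ≤ k‖a − b‖` in the
unit disc) and `MatomakiRadziwillL14Refutation.norm_cexp_mul_I_sub_cexp_mul_I_le` (reused, not restated),
`tendsto_pow_exp_of_tendsto_mul_sub_one` (`k n (a n − 1) → c`, `a n → 1` ⇒ `(a n)^{k n} → e^c`), the telescoping estimate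
`norm_integral_cexp_sum_sub_prod_le`, and the one-block expansion `norm_charFun_sub_one_sub_le`
(`‖E[e^{itY}] − (1 − t²E[Y²]/2)‖ ≤ (|t|³b/6 + t⁴b²/24)·E[Y²]` for centred `|Y| ≤ b`).
WHAT THIS IS NOT: not a statement about any lattice model (that is `BoxSumCLT.lean`); no rate (no Berry–Esseen).
References: I. A. Ibragimov, Yu. V. Linnik, *Independent and Stationary Sequences of Random Variables* (1971), Ch. 18 (Bernstein's
blocks); E. Bolthausen, Ann. Probab. 10 (1982) 1047–1050; P. Billingsley, *Probability and Measure*, Thm. 27.4; Mathlib's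
`Mathlib.Probability.CentralLimitTheorem` (the i.i.d. case, whose infrastructure is reused).
-/

noncomputable section

open MeasureTheory ProbabilityTheory Filter Topology Complex Finset
open scoped Real

namespace Summit.Ventures.YMGap.RobustBall

namespace BlockCLT

/-! ### Elementary estimates -/

/-- Half-angle form of the cosine remainder: `|cos x − (1 − x²/2)| ≤ x⁴/24`. [folklore] -/
theorem abs_cos_sub_taylor_le (x : ℝ) : |Real.cos x - (1 - x ^ 2 / 2)| ≤ x ^ 4 / 24 := by
  set s := x / 2 with hs
  have hx : x = 2 * s := by rw [hs]; ring
  have h1 : Real.cos x - (1 - x ^ 2 / 2) = 2 * ((s - Real.sin s) * (s + Real.sin s)) := by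
    rw [hx]; linear_combination (2 : ℝ) * Real.sin_sq_eq_half_sub s
  have hB : |s + Real.sin s| ≤ 2 * |s| := by
    have := Real.abs_sin_le_abs (x := s)
    calc |s + Real.sin s| ≤ |s| + |Real.sin s| := abs_add_le _ _
      _ ≤ 2 * |s| := by linarith
  have h4 : |s| ^ 4 = s ^ 4 := by rw [← abs_pow, abs_of_nonneg (by positivity)]
  rw [h1, abs_mul, abs_mul, abs_two]
  calc 2 * (|s - Real.sin s| * |s + Real.sin s|) ≤ 2 * (|s| ^ 3 / 6 * (2 * |s|)) := by
        gcongr; exact Real.abs_sub_sin_le s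
    _ = x ^ 4 / 24 := by rw [hx]; nlinarith [h4]

/-- **Second-order Taylor remainder of `e^{ix}` for real `x`**: `‖e^{ix} − (1 + ix − x²/2)‖ ≤ |x|³/6 + x⁴/24`. [folklore] -/
theorem norm_cexp_sub_taylor_le (x : ℝ) :
    ‖cexp ((x : ℂ) * I) - (1 + (x : ℂ) * I - (x : ℂ) ^ 2 / 2)‖ ≤ |x| ^ 3 / 6 + x ^ 4 / 24 := by
  have hre : cexp ((x : ℂ) * I) - (1 + (x : ℂ) * I - (x : ℂ) ^ 2 / 2) =
      ((Real.cos x - (1 - x ^ 2 / 2) : ℝ) : ℂ) + ((Real.sin x - x : ℝ) : ℂ) * I := by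
    rw [exp_mul_I, ← ofReal_cos, ← ofReal_sin]; push_cast; ring
  rw [hre]
  have hs : |Real.sin x - x| ≤ |x| ^ 3 / 6 := by rw [abs_sub_comm]; exact Real.abs_sub_sin_le x
  calc ‖((Real.cos x - (1 - x ^ 2 / 2) : ℝ) : ℂ) + ((Real.sin x - x : ℝ) : ℂ) * I‖
      ≤ ‖((Real.cos x - (1 - x ^ 2 / 2) : ℝ) : ℂ)‖ + ‖((Real.sin x - x : ℝ) : ℂ) * I‖ := norm_add_le _ _
    _ = |Real.cos x - (1 - x ^ 2 / 2)| + |Real.sin x - x| := by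
        rw [norm_mul, Complex.norm_I, mul_one, Complex.norm_real, Complex.norm_real, Real.norm_eq_abs, Real.norm_eq_abs]
    _ ≤ x ^ 4 / 24 + |x| ^ 3 / 6 := add_le_add (abs_cos_sub_taylor_le x) hs
    _ = |x| ^ 3 / 6 + x ^ 4 / 24 := by ring

/-- **`(a n)^{k n} → e^{c}`** whenever `k n · (a n − 1) → c` and `a n → 1` (real; the exponents `k n` are arbitrary naturals, not the
running index): `|k log a − k(a − 1)| ≤ 2|k(a − 1)|·|a − 1| → 0`. [folklore] -/
theorem tendsto_pow_exp_of_tendsto_mul_sub_one {a : ℕ → ℝ} {k : ℕ → ℕ} {c : ℝ}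
    (hk : Tendsto (fun n => (k n : ℝ) * (a n - 1)) atTop (𝓝 c)) (ha : Tendsto a atTop (𝓝 1)) :
    Tendsto (fun n => a n ^ k n) atTop (𝓝 (Real.exp c)) := by
  have hev : ∀ᶠ n in atTop, |a n - 1| ≤ 1 / 2 := by
    filter_upwards [(Metric.tendsto_nhds.1 ha) (1 / 2) (by norm_num)] with n hn
    rw [Real.dist_eq] at hn
    exact hn.le
  have hlog : ∀ᶠ n in atTop, |(k n : ℝ) * Real.log (a n) - (k n : ℝ) * (a n - 1)| ≤ 2 * |(k n : ℝ) * (a n - 1)| * |a n - 1| := by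
    filter_upwards [hev] with n hn
    have hx : |1 - a n| < 1 := by rw [abs_sub_comm]; linarith
    have h : |1 - a n + Real.log (a n)| ≤ (1 - a n) ^ 2 / (1 - |1 - a n|) := by
      have h := Real.abs_log_sub_add_sum_range_le hx 1
      simp only [Finset.sum_range_one, zero_add, pow_one] at h
      norm_num at h
      exact h
    have h2 : |Real.log (a n) - (a n - 1)| ≤ 2 * |a n - 1| ^ 2 := by
      rw [show 1 - a n + Real.log (a n) = Real.log (a n) - (a n - 1) by ring] at h
      refine h.trans ?_
      have hden : (1 : ℝ) / 2 ≤ 1 - |1 - a n| := by rw [abs_sub_comm] at hn; linarith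
      calc (1 - a n) ^ 2 / (1 - |1 - a n|) ≤ (1 - a n) ^ 2 / (1 / 2) :=
            div_le_div_of_nonneg_left (by positivity) (by norm_num) hden
        _ = 2 * |a n - 1| ^ 2 := by rw [sq_abs]; ring
    calc |(k n : ℝ) * Real.log (a n) - (k n : ℝ) * (a n - 1)| = (k n : ℝ) * |Real.log (a n) - (a n - 1)| := by
          rw [← mul_sub, abs_mul, Nat.abs_cast]
      _ ≤ (k n : ℝ) * (2 * |a n - 1| ^ 2) := by gcongr
      _ = 2 * |(k n : ℝ) * (a n - 1)| * |a n - 1| := by rw [abs_mul, Nat.abs_cast]; ring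
  have hzero : Tendsto (fun n => 2 * |(k n : ℝ) * (a n - 1)| * |a n - 1|) atTop (𝓝 0) := by
    have h1 : Tendsto (fun n => a n - 1) atTop (𝓝 0) := by simpa using ha.sub_const 1
    simpa using (hk.abs.const_mul 2).mul h1.abs
  have hklog : Tendsto (fun n => (k n : ℝ) * Real.log (a n)) atTop (𝓝 c) := by
    have hdiff : Tendsto (fun n => (k n : ℝ) * Real.log (a n) - (k n : ℝ) * (a n - 1)) atTop (𝓝 0) :=
      squeeze_zero_norm' (by filter_upwards [hlog] with n hn; simpa [Real.norm_eq_abs] using hn) hzero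
    simpa using hdiff.add hk
  refine ((Real.continuous_exp.tendsto c).comp hklog).congr' ?_
  filter_upwards [hev] with n hn
  have hpos : 0 < a n := by have := (abs_le.1 hn).1; linarith
  simp only [Function.comp]
  rw [← Real.log_pow, Real.exp_log (pow_pos hpos _)]

/-! ### Random phases: integrability, the telescoping estimate, the one-block expansion -/

variable {Ω : Type*} [MeasurableSpace Ω] {μ : Measure Ω}

/-- `e^{itX}` is integrable for a.e.-measurable real `X` on a probability space. [folklore] -/
theorem integrable_cexp_mul_I [IsProbabilityMeasure μ] {X : Ω → ℝ} (hX : AEMeasurable X μ) (t : ℝ) :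
    Integrable (fun ω => cexp (((t * X ω : ℝ) : ℂ) * I)) μ := by
  refine (integrable_const (1 : ℝ)).mono' ?_ (Eventually.of_forall fun ω => ?_)
  · exact ((Complex.measurable_ofReal.comp_aemeasurable (hX.const_mul t)).mul_const I).cexp.aestronglyMeasurable
  · rw [Complex.norm_exp_ofReal_mul_I]

/-- `‖E[e^{itX}]‖ ≤ 1` on a probability space. [folklore] -/
theorem norm_integral_cexp_mul_I_le [IsProbabilityMeasure μ] (X : Ω → ℝ) (t : ℝ) :
    ‖∫ ω, cexp (((t * X ω : ℝ) : ℂ) * I) ∂μ‖ ≤ 1 := by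
  calc ‖∫ ω, cexp (((t * X ω : ℝ) : ℂ) * I) ∂μ‖ ≤ 1 * μ.real Set.univ :=
        norm_integral_le_of_norm_le_const (Eventually.of_forall fun ω => by rw [Complex.norm_exp_ofReal_mul_I])
    _ = 1 := by rw [one_mul, probReal_univ]

/-- **THE TELESCOPING ESTIMATE.** For measurable real `Y 0, …, Y (k−1)` on a probability space and real `t`:
`‖E[e^{it Σ_{i<k} Y i}] − Π_{i<k} E[e^{it Y i}]‖ ≤ Σ_{j<k} ‖E[e^{it Σ_{i∈[j,k)} Y i}] − E[e^{it Y j}] · E[e^{it Σ_{i∈[j+1,k)} Y i}]‖`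
(peel off the first factor, `‖E[e^{itY 0}]‖ ≤ 1`, and recurse on the shifted family). [folklore] -/
theorem norm_integral_cexp_sum_sub_prod_le [IsProbabilityMeasure μ] (t : ℝ) (k : ℕ) :
    ∀ Y : ℕ → Ω → ℝ, (∀ i, Measurable (Y i)) →
      ‖(∫ ω, cexp (((t * ∑ i ∈ range k, Y i ω : ℝ) : ℂ) * I) ∂μ) -
          ∏ i ∈ range k, ∫ ω, cexp (((t * Y i ω : ℝ) : ℂ) * I) ∂μ‖ ≤
        ∑ j ∈ range k, ‖(∫ ω, cexp (((t * ∑ i ∈ Ico j k, Y i ω : ℝ) : ℂ) * I) ∂μ) -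
          (∫ ω, cexp (((t * Y j ω : ℝ) : ℂ) * I) ∂μ) *
            ∫ ω, cexp (((t * ∑ i ∈ Ico (j + 1) k, Y i ω : ℝ) : ℂ) * I) ∂μ‖ := by
  induction k with
  | zero => intro Y _; simp
  | succ k ih =>
    intro Y hY
    have ih' := ih (fun i => Y (i + 1)) (fun i => hY (i + 1))
    have hshift : ∀ (j : ℕ) (ω : Ω), ∑ i ∈ Ico (j + 1) (k + 1), Y i ω = ∑ i ∈ Ico j k, Y (i + 1) ω := fun j ω => by
      rw [← Finset.image_add_right_Ico j k 1, Finset.sum_image (fun a _ b _ h => by simpa using h)]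
    set A : ℂ := ∫ ω, cexp (((t * Y 0 ω : ℝ) : ℂ) * I) ∂μ with hA
    set P : ℂ := ∫ ω, cexp (((t * ∑ i ∈ range k, Y (i + 1) ω : ℝ) : ℂ) * I) ∂μ with hP
    set Q : ℂ := ∏ i ∈ range k, ∫ ω, cexp (((t * Y (i + 1) ω : ℝ) : ℂ) * I) ∂μ with hQ
    set Tot : ℂ := ∫ ω, cexp (((t * ∑ i ∈ range (k + 1), Y i ω : ℝ) : ℂ) * I) ∂μ with hTot
    have hprod : ∏ i ∈ range (k + 1), ∫ ω, cexp (((t * Y i ω : ℝ) : ℂ) * I) ∂μ = A * Q := by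
      rw [Finset.prod_range_succ', mul_comm]
    have hIco0 : ∀ ω : Ω, ∑ i ∈ Ico 0 (k + 1), Y i ω = ∑ i ∈ range (k + 1), Y i ω := fun ω => by rw [Finset.range_eq_Ico]
    have hIco1 : ∀ ω : Ω, ∑ i ∈ Ico (0 + 1) (k + 1), Y i ω = ∑ i ∈ range k, Y (i + 1) ω := fun ω => by
      rw [hshift 0 ω, Finset.range_eq_Ico]
    have hrhs : ∑ j ∈ range (k + 1), ‖(∫ ω, cexp (((t * ∑ i ∈ Ico j (k + 1), Y i ω : ℝ) : ℂ) * I) ∂μ) -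
          (∫ ω, cexp (((t * Y j ω : ℝ) : ℂ) * I) ∂μ) * ∫ ω, cexp (((t * ∑ i ∈ Ico (j + 1) (k + 1), Y i ω : ℝ) : ℂ) * I) ∂μ‖ =
        ‖Tot - A * P‖ + ∑ j ∈ range k, ‖(∫ ω, cexp (((t * ∑ i ∈ Ico j k, Y (i + 1) ω : ℝ) : ℂ) * I) ∂μ) -
          (∫ ω, cexp (((t * Y (j + 1) ω : ℝ) : ℂ) * I) ∂μ) *
            ∫ ω, cexp (((t * ∑ i ∈ Ico (j + 1) k, Y (i + 1) ω : ℝ) : ℂ) * I) ∂μ‖ := by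
      rw [Finset.sum_range_succ', add_comm]
      congr 1
      · simp_rw [hIco0, hIco1]; rfl
      · exact Finset.sum_congr rfl fun j _ => by simp_rw [hshift]
    rw [hrhs, hprod, show Tot - A * Q = (Tot - A * P) + A * (P - Q) by ring]
    have hAle : ‖A‖ ≤ 1 := norm_integral_cexp_mul_I_le _ _
    calc ‖Tot - A * P + A * (P - Q)‖ ≤ ‖Tot - A * P‖ + ‖A‖ * ‖P - Q‖ := by
          refine (norm_add_le _ _).trans ?_; rw [norm_mul]
      _ ≤ ‖Tot - A * P‖ + 1 * ‖P - Q‖ := by gcongr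
      _ ≤ _ := by rw [one_mul]; gcongr

/-- **Second-order expansion of `E[e^{itY}]` for a centred bounded block**: `Y` measurable, `|Y| ≤ b`, `E[Y] = 0` ⇒
`‖E[e^{itY}] − (1 − t² E[Y²]/2)‖ ≤ (|t|³ b/6 + t⁴ b²/24) · E[Y²]` (`|Y|³ ≤ b Y²`, `Y⁴ ≤ b² Y²`). [folklore] -/
theorem norm_charFun_sub_one_sub_le [IsProbabilityMeasure μ] {Y : Ω → ℝ} (hY : Measurable Y) {b : ℝ}
    (hb : ∀ ω, |Y ω| ≤ b) (h0 : ∫ ω, Y ω ∂μ = 0) (t : ℝ) :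
    ‖(∫ ω, cexp (((t * Y ω : ℝ) : ℂ) * I) ∂μ) - ((1 - t ^ 2 * (∫ ω, Y ω ^ 2 ∂μ) / 2 : ℝ) : ℂ)‖ ≤
      (|t| ^ 3 * b / 6 + t ^ 4 * b ^ 2 / 24) * ∫ ω, Y ω ^ 2 ∂μ := by
  set v : ℝ := ∫ ω, Y ω ^ 2 ∂μ with hv
  have hYi : Integrable Y μ :=
    (integrable_const b).mono' hY.aestronglyMeasurable (Eventually.of_forall fun ω => by simpa [Real.norm_eq_abs] using hb ω)
  have hsq_le : ∀ ω, Y ω ^ 2 ≤ b ^ 2 := fun ω => by rw [← sq_abs]; exact pow_le_pow_left₀ (abs_nonneg _) (hb ω) 2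
  have hY2i : Integrable (fun ω => Y ω ^ 2) μ :=
    (integrable_const (b ^ 2)).mono' (hY.pow_const 2).aestronglyMeasurable (Eventually.of_forall fun ω => by
      rw [Real.norm_eq_abs, abs_of_nonneg (sq_nonneg _)]; exact hsq_le ω)
  -- the phase `e` and its second-order Taylor polynomial `g`
  set e : Ω → ℂ := fun ω => cexp (((t * Y ω : ℝ) : ℂ) * I) with he
  set g : Ω → ℂ := fun ω => ((1 - (t * Y ω) ^ 2 / 2 : ℝ) : ℂ) + ((t * Y ω : ℝ) : ℂ) * I with hg
  have hp_i : Integrable (fun ω => (1 - (t * Y ω) ^ 2 / 2 : ℝ)) μ := by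
    rw [show (fun ω => (1 - (t * Y ω) ^ 2 / 2 : ℝ)) = fun ω => 1 - (t ^ 2 / 2) * Y ω ^ 2 by funext ω; ring]
    exact (integrable_const _).sub (hY2i.const_mul _)
  have h1i : Integrable (fun ω => ((1 - (t * Y ω) ^ 2 / 2 : ℝ) : ℂ)) μ := hp_i.ofReal
  have h2i : Integrable (fun ω => ((t * Y ω : ℝ) : ℂ) * I) μ := (hYi.const_mul t).ofReal.mul_const I
  have hp : ∫ ω, (1 - (t * Y ω) ^ 2 / 2 : ℝ) ∂μ = 1 - t ^ 2 * v / 2 := by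
    rw [show (fun ω => (1 - (t * Y ω) ^ 2 / 2 : ℝ)) = fun ω => 1 - (t ^ 2 / 2) * Y ω ^ 2 by funext ω; ring,
      integral_sub (integrable_const _) (hY2i.const_mul _), integral_const, integral_const_mul]
    simp [hv]; ring
  have hg_int : ∫ ω, g ω ∂μ = ((1 - t ^ 2 * v / 2 : ℝ) : ℂ) := by
    have hsum : ∫ ω, (((1 - (t * Y ω) ^ 2 / 2 : ℝ) : ℂ) + ((t * Y ω : ℝ) : ℂ) * I) ∂μ =
        (∫ ω, ((1 - (t * Y ω) ^ 2 / 2 : ℝ) : ℂ) ∂μ) + ∫ ω, ((t * Y ω : ℝ) : ℂ) * I ∂μ := integral_add h1i h2i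
    have hI : ∫ ω, ((t * Y ω : ℝ) : ℂ) * I ∂μ = (∫ ω, ((t * Y ω : ℝ) : ℂ) ∂μ) * I := integral_mul_const I _
    have hc2 : ∫ ω, ((t * Y ω : ℝ) : ℂ) ∂μ = 0 := by
      rw [integral_complex_ofReal, integral_const_mul, h0, mul_zero]; simp
    simp only [hg]
    rw [hsum, hI, integral_complex_ofReal, hp, hc2, zero_mul, add_zero]
  -- pointwise Taylor bound
  have hpt : ∀ ω, ‖e ω - g ω‖ ≤ (|t| ^ 3 * b / 6 + t ^ 4 * b ^ 2 / 24) * Y ω ^ 2 := fun ω => by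
    rw [he, show g ω = 1 + ((t * Y ω : ℝ) : ℂ) * I - ((t * Y ω : ℝ) : ℂ) ^ 2 / 2 by rw [hg]; push_cast; ring]
    refine (norm_cexp_sub_taylor_le (t * Y ω)).trans ?_
    have h3 : |t * Y ω| ^ 3 ≤ |t| ^ 3 * b * Y ω ^ 2 := by
      rw [abs_mul, mul_pow, show |Y ω| ^ 3 = |Y ω| * Y ω ^ 2 by rw [← sq_abs]; ring]
      have := mul_le_mul_of_nonneg_right (hb ω) (sq_nonneg (Y ω))
      nlinarith [pow_nonneg (abs_nonneg t) 3]
    have h4 : (t * Y ω) ^ 4 ≤ t ^ 4 * b ^ 2 * Y ω ^ 2 := by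
      rw [mul_pow, show Y ω ^ 4 = Y ω ^ 2 * Y ω ^ 2 by ring]
      have := mul_le_mul_of_nonneg_right (hsq_le ω) (sq_nonneg (Y ω))
      nlinarith [pow_nonneg (sq_nonneg t) 2]
    nlinarith [h3, h4]
  have hgi : Integrable g μ := h1i.add h2i
  rw [show (∫ ω, e ω ∂μ) - ((1 - t ^ 2 * v / 2 : ℝ) : ℂ) = ∫ ω, (e ω - g ω) ∂μ by
    rw [integral_sub (integrable_cexp_mul_I hY.aemeasurable t) hgi, hg_int]]
  refine (norm_integral_le_of_norm_le (hY2i.const_mul _) (Eventually.of_forall hpt)).trans ?_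
  rw [integral_const_mul]

/-! ### The criterion -/

/-- ★ **THE BERNSTEIN-BLOCK CRITERION (characteristic functions).** On a probability space let `T n = Σ_{j<k n} Y n j + R n`
with: `∫|R n| → 0`; the `Y n j` (`j < k n`) measurable, distributed as `Y n 0`, `E[Y n 0] = 0`, `|Y n j| ≤ b n`, `b n → 0`;
`k n · E[(Y n 0)²] → σ²`; and for every `t` the dependence defect
`Σ_{j<k n} ‖E[e^{it Σ_{i∈[j,k n)} Y n i}] − E[e^{it Y n j}] E[e^{it Σ_{i∈[j+1,k n)} Y n i}]‖ → 0`. Then `E[e^{it T n}] → e^{−σ² t²/2}` for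
every `t`. (Blocks: `E[e^{itY}] = 1 − t²E[Y²]/2 + O(b·E[Y²])`, `(1 − t²v_n/2)^{k n} → e^{−σ²t²/2}`, powers are `k`-Lipschitz in the
disc; identical distribution turns the product of the block characteristic functions into a power.) [folklore] -/
theorem tendsto_integral_cexp_of_blocks [IsProbabilityMeasure μ] {T R : ℕ → Ω → ℝ} {Y : ℕ → ℕ → Ω → ℝ}
    {k : ℕ → ℕ} {b : ℕ → ℝ} {σ2 : ℝ} (hT : ∀ n ω, T n ω = (∑ j ∈ range (k n), Y n j ω) + R n ω)
    (hYm : ∀ n j, Measurable (Y n j)) (hRi : ∀ n, Integrable (R n) μ)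
    (hR : Tendsto (fun n => ∫ ω, |R n ω| ∂μ) atTop (𝓝 0)) (hid : ∀ n, ∀ j < k n, IdentDistrib (Y n j) (Y n 0) μ μ)
    (h0 : ∀ n, ∫ ω, Y n 0 ω ∂μ = 0) (hb : ∀ n j ω, |Y n j ω| ≤ b n) (hb0 : Tendsto b atTop (𝓝 0))
    (hv : Tendsto (fun n => (k n : ℝ) * ∫ ω, Y n 0 ω ^ 2 ∂μ) atTop (𝓝 σ2))
    (hdep : ∀ t : ℝ, Tendsto (fun n => ∑ j ∈ range (k n),
        ‖(∫ ω, cexp (((t * ∑ i ∈ Ico j (k n), Y n i ω : ℝ) : ℂ) * I) ∂μ) -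
          (∫ ω, cexp (((t * Y n j ω : ℝ) : ℂ) * I) ∂μ) *
            ∫ ω, cexp (((t * ∑ i ∈ Ico (j + 1) (k n), Y n i ω : ℝ) : ℂ) * I) ∂μ‖) atTop (𝓝 0))
    (t : ℝ) :
    Tendsto (fun n => ∫ ω, cexp (((t * T n ω : ℝ) : ℂ) * I) ∂μ) atTop (𝓝 (((Real.exp (-(σ2 * t ^ 2 / 2)) : ℝ) : ℂ))) := by
  set v : ℕ → ℝ := fun n => ∫ ω, Y n 0 ω ^ 2 ∂μ with hvdef
  set φ : ℕ → ℂ := fun n => ∫ ω, cexp (((t * Y n 0 ω : ℝ) : ℂ) * I) ∂μ with hφ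
  set a : ℕ → ℝ := fun n => 1 - t ^ 2 * v n / 2 with ha
  set S : ℕ → Ω → ℝ := fun n ω => ∑ j ∈ range (k n), Y n j ω with hS
  have hSm : ∀ n, Measurable (S n) := fun n => Finset.measurable_sum _ fun j _ => hYm n j
  have hTm : ∀ n, AEMeasurable (T n) μ := fun n => by
    rw [show T n = fun ω => S n ω + R n ω from funext fun ω => by rw [hT n ω]]
    exact (hSm n).aemeasurable.add (hRi n).aemeasurable
  -- `0 ≤ v n ≤ (b n)²`, so `v n → 0`, `a n → 1`, `k n (a n − 1) → −σ² t²/2`, `(a n)^{k n} → e^{−σ²t²/2}`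
  have hv0 : ∀ n, 0 ≤ v n := fun n => integral_nonneg fun ω => sq_nonneg _
  have hvb : ∀ n, v n ≤ b n ^ 2 := fun n => by
    have h := integral_mono_of_nonneg (μ := μ) (f := fun ω => Y n 0 ω ^ 2) (g := fun _ => b n ^ 2)
      (Eventually.of_forall fun ω => sq_nonneg _) (integrable_const _) (Eventually.of_forall fun ω => by
        show Y n 0 ω ^ 2 ≤ b n ^ 2
        rw [← sq_abs]; exact pow_le_pow_left₀ (abs_nonneg _) (hb n 0 ω) 2)
    simpa using h
  have hvt : Tendsto v atTop (𝓝 0) := squeeze_zero hv0 hvb (by simpa using hb0.pow 2)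
  have hat : Tendsto a atTop (𝓝 1) := by simpa [ha] using ((hvt.const_mul (t ^ 2)).div_const 2).const_sub 1
  have hka : Tendsto (fun n => (k n : ℝ) * (a n - 1)) atTop (𝓝 (-(t ^ 2 / 2) * σ2)) :=
    (hv.const_mul (-(t ^ 2 / 2))).congr fun n => by simp only [ha]; ring
  have hpow : Tendsto (fun n => a n ^ k n) atTop (𝓝 (Real.exp (-(σ2 * t ^ 2 / 2)))) := by
    rw [show -(σ2 * t ^ 2 / 2) = -(t ^ 2 / 2) * σ2 by ring]
    exact tendsto_pow_exp_of_tendsto_mul_sub_one hka hat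
  -- `k n ‖φ n − a n‖ → 0`, hence `φ n ^ k n − (a n)^{k n} → 0`
  have hkφa : Tendsto (fun n => (k n : ℝ) * ‖φ n - (a n : ℂ)‖) atTop (𝓝 0) := by
    have hlim : Tendsto (fun n => (|t| ^ 3 * b n / 6 + t ^ 4 * b n ^ 2 / 24) * ((k n : ℝ) * v n)) atTop (𝓝 0) := by
      have hcoef : Tendsto (fun n => |t| ^ 3 * b n / 6 + t ^ 4 * b n ^ 2 / 24) atTop (𝓝 0) := by
        simpa using ((hb0.const_mul (|t| ^ 3)).div_const 6).add (((hb0.pow 2).const_mul (t ^ 4)).div_const 24)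
      simpa using hcoef.mul hv
    refine squeeze_zero (fun n => by positivity) (fun n => ?_) hlim
    calc (k n : ℝ) * ‖φ n - (a n : ℂ)‖ ≤ (k n : ℝ) * ((|t| ^ 3 * b n / 6 + t ^ 4 * b n ^ 2 / 24) * v n) := by
          gcongr; exact norm_charFun_sub_one_sub_le (hYm n 0) (hb n 0) (h0 n) t
      _ = (|t| ^ 3 * b n / 6 + t ^ 4 * b n ^ 2 / 24) * ((k n : ℝ) * v n) := by ring
  have ha_le : ∀ᶠ n in atTop, ‖(a n : ℂ)‖ ≤ 1 := by
    filter_upwards [(Metric.tendsto_nhds.1 ((hvt.const_mul (t ^ 2)).div_const 2)) 1 one_pos] with n hn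
    rw [Real.dist_eq] at hn
    simp only [zero_div, mul_zero, sub_zero] at hn
    rw [Complex.norm_real, Real.norm_eq_abs, ha, abs_le]
    have hnn : 0 ≤ t ^ 2 * v n / 2 := by have := hv0 n; positivity
    constructor <;> nlinarith [(abs_lt.1 hn).2]
  have hφpow : Tendsto (fun n => φ n ^ k n) atTop (𝓝 (((Real.exp (-(σ2 * t ^ 2 / 2)) : ℝ) : ℂ))) := by
    have hD : Tendsto (fun n => φ n ^ k n - (a n : ℂ) ^ k n) atTop (𝓝 0) := by
      refine squeeze_zero_norm' ?_ hkφa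
      filter_upwards [ha_le] with n hn
      exact Literature.NumberTheory.LFunctions.Konieczny.norm_pow_sub_pow_le (norm_integral_cexp_mul_I_le _ _) hn (k n)
    have h := hD.add ((Complex.continuous_ofReal.tendsto _).comp hpow)
    simp only [zero_add] at h
    exact h.congr fun n => by simp only [Function.comp_apply]; push_cast; ring
  -- identical distribution: the product of the block characteristic functions is `φ n ^ k n`; the defect; the remainder
  have hE : ∀ n, ∏ j ∈ range (k n), ∫ ω, cexp (((t * Y n j ω : ℝ) : ℂ) * I) ∂μ = φ n ^ k n := fun n => by
    have hmeas : Measurable fun x : ℝ => cexp (((t * x : ℝ) : ℂ) * I) :=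
      ((Complex.measurable_ofReal.comp (measurable_const.mul measurable_id)).mul_const I).cexp
    calc ∏ j ∈ range (k n), ∫ ω, cexp (((t * Y n j ω : ℝ) : ℂ) * I) ∂μ = ∏ j ∈ range (k n), φ n :=
          Finset.prod_congr rfl fun j hj => ((hid n j (Finset.mem_range.1 hj)).comp hmeas).integral_eq
      _ = φ n ^ k n := by rw [Finset.prod_const, Finset.card_range]
  have hF : Tendsto (fun n => (∫ ω, cexp (((t * S n ω : ℝ) : ℂ) * I) ∂μ) - φ n ^ k n) atTop (𝓝 0) := by
    refine squeeze_zero_norm' (Eventually.of_forall fun n => ?_) (hdep t)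
    rw [← hE n]
    exact norm_integral_cexp_sum_sub_prod_le t (k n) (Y n) (hYm n)
  have hG : Tendsto (fun n => (∫ ω, cexp (((t * T n ω : ℝ) : ℂ) * I) ∂μ) - ∫ ω, cexp (((t * S n ω : ℝ) : ℂ) * I) ∂μ)
      atTop (𝓝 0) := by
    refine squeeze_zero_norm' (Eventually.of_forall fun n => ?_) (by simpa using hR.const_mul |t|)
    rw [← integral_sub (integrable_cexp_mul_I (hTm n) t) (integrable_cexp_mul_I (hSm n).aemeasurable t), ← integral_const_mul]
    refine norm_integral_le_of_norm_le ((hRi n).abs.const_mul _) (Eventually.of_forall fun ω => ?_)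
    refine (Literature.NumberTheory.Sieve.MatomakiRadziwillL14Refutation.norm_cexp_mul_I_sub_cexp_mul_I_le _ _).trans ?_
    rw [hT n ω, hS]
    simp only
    rw [show t * (∑ j ∈ range (k n), Y n j ω + R n ω) - t * ∑ j ∈ range (k n), Y n j ω = t * R n ω by ring, abs_mul]
  have hsum := (hG.add hF).add hφpow
  simp only [zero_add] at hsum
  exact hsum.congr fun n => by ring

/-- ★★ **LÉVY STEP — CONVERGENCE IN DISTRIBUTION TO THE GAUSSIAN from the characteristic functions.** If the `T n` are
a.e.-measurable, `0 ≤ σ²` and `E[e^{it T n}] → e^{−σ²t²/2}` for every `t`, then `T n → N(0, σ²)` in distribution: for every random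
variable `Z` with law `gaussianReal 0 σ²` on any probability space, `TendstoInDistribution T atTop Z` (Mathlib's Lévy continuity
theorem `ProbabilityMeasure.tendsto_iff_tendsto_charFun` and `charFun_gaussianReal`). With `tendsto_integral_cexp_of_blocks` this is
the Bernstein-block CLT. [folklore] -/
theorem tendstoInDistribution_of_tendsto_integral_cexp [IsProbabilityMeasure μ] {T : ℕ → Ω → ℝ} {σ2 : ℝ} (hσ : 0 ≤ σ2)
    (hTm : ∀ n, AEMeasurable (T n) μ)
    (hlim : ∀ t : ℝ, Tendsto (fun n => ∫ ω, cexp (((t * T n ω : ℝ) : ℂ) * I) ∂μ) atTop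
      (𝓝 (((Real.exp (-(σ2 * t ^ 2 / 2)) : ℝ) : ℂ))))
    {Ω' : Type*} [MeasurableSpace Ω'] {P' : Measure Ω'} [IsProbabilityMeasure P'] {Z : Ω' → ℝ}
    (hZ : HasLaw Z (gaussianReal 0 σ2.toNNReal) P') : TendstoInDistribution T atTop Z (fun _ => μ) P' := by
  refine ⟨hTm, hZ.aemeasurable, ProbabilityMeasure.tendsto_iff_tendsto_charFun.2 fun t => ?_⟩
  have hcf : ∀ n, charFun (μ.map (T n)) t = ∫ ω, cexp (((t * T n ω : ℝ) : ℂ) * I) ∂μ := fun n => by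
    rw [charFun_apply_real, integral_map (hTm n) (Continuous.aestronglyMeasurable (by fun_prop))]
    simp_rw [Complex.ofReal_mul]
  have hgauss : charFun (P'.map Z) t = ((Real.exp (-(σ2 * t ^ 2 / 2)) : ℝ) : ℂ) := by
    rw [hZ.map_eq, charFun_gaussianReal]
    push_cast
    rw [Real.coe_toNNReal _ hσ]
    simp
  simp only [ProbabilityMeasure.coe_mk, hcf, hgauss]
  exact hlim t

end BlockCLT

end Summit.Ventures.YMGap.RobustBall

end
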